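import Mathlib
import Literature.Computability.Complexity.Circuit
import Literature.Computability.Complexity.CircuitClasses
import Literature.Computability.Complexity.ConstantDepth
import Literature.Computability.Complexity.CircuitRestriction
import Literature.Computability.MetaComplexity.CircuitMagnification
import Literature.Computability.MetaComplexity.ChenJinWilliams2019.SearchMagnification
import Literature.Computability.MetaComplexity.ChenJinWilliams2019.SparseConstantDepthMagnification
import HarnessLib

/-!
# McKay–Murray–Williams 2019, Theorem 1.4 (bullets 1 and 2) and Theorem 1.6: the DEPTH-bounded
# magnification thresholds for `search-MCSP` (census rows R31, R32, R40)

D. M. McKay, C. D. Murray, R. R. Williams, *Weak lower bounds on resource-bounded compression imply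
strong separations of complexity classes*, STOC 2019, 1215–1225, doi:10.1145/3313276.3316396
[bib: `MckayMurrayWilliams2019`; held text `paper:doi-10-1145-3313276-3316396`, locators below are
its 3000-character chunks `p0003`, `p0004`, `p0016`, `p0020`, not PDF pages].

VERBATIM (chunk p0003, §1.1): *"Theorem 1.4 (Section 5). Let s(n) ≥ n, and let A ∈ PH.
• If there exists an ε > 0 such that for every c ≥ 1, the problem search-MCSP^A[2^{εn/c}] on inputs
  of length N = 2^n does not have N^{1+ε}-size O(1/ε)-depth TC⁰ circuits, then NP ⊄ TC⁰.
• If search-MCSP^A[s(n)] on inputs of length N = 2^n does not have circuits of N · poly(s(n)) size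
  and O(log N) depth, then NP ⊄ NC¹.
• If search-MCSP^A[s(n)] on inputs of length N = 2^n does not have circuits of N · poly(s(n)) size
  and poly(s(n)) depth, then NP ⊄ P/poly."* (The third bullet — in the depth-free, decision, `A = ∅`
form it implies — is `MckayMurrayWilliams2019_thm14` of `CircuitMagnification.lean`, census row R4;
referee A4.)

VERBATIM (chunk p0004): *"Theorem 1.6. Let C be one of NP, PP, ⊕P, or PSPACE. Suppose there is some
s(n) and oracle A ∈ C such that for all c ≥ 1, search-MCSP^A[s(n)] on inputs of length 2^n has no
circuits of depth O(n) and 2^n · s(n)^c size. Then C does not have polynomial-size formulas (i.e.,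
C ⊄ NC¹)."* (§5, chunk p0020, restates it as "Reminder of Theorem 1.6" with
*"C ∈ {NP, PP, ⊕P, PSPACE, EXP}"*.)

PROOFS in print (chunk p0016, §5): both bullets and Thm. 1.6 are contrapositives of the circuit
construction Theorem 1.1 / Lemma 3.1 (Thm. 1.1, chunk p0003: *"There is a uniform AC circuit family for
MCSP^A[s(n)] on 2^n-bit inputs of Õ(2^n · s(n)²) size and O(n/log ℓ(n)) depth with Σ₃SAT^A oracle gates,
where each oracle gate takes only Õ(ℓ(n)) bits of input."*; §5, chunk p0020: *"the oracle circuit family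
constructed in Lemma 3.1 of O(2^n · s(n)/ℓ(n)) size and O(n/log ℓ(n)) depth"*; Lemma 3.1's own statement
— the search version with Circuit-Min-Merge^A gates on ℓ(n)-bit blocks — is not in the held chunk
extraction and is PARAPHRASED here, not quoted): bullet 1 with `s = N^{ε/c}`, `ℓ = N^{2ε/c}`, depth
`O(c/ε)`, each oracle/merge gate replaced by the assumed `TC⁰` circuits of `poly(N^{2ε/c})` size and
*"set c large enough to obtain a TC⁰ circuit of N^{1+ε}-size"*; bullet 2 with `ℓ = s³`, depth
`O((log N / log s) · log s) = O(log N)`; Thm. 1.6 with `O(2^n)` formulas for Circuit-Min-Merge^A of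
depth `O(log ℓ)`, total depth `O(n)`, size `2^n · poly(s(n))`.

## Rendering (why each typed `Prop` is implied by the printed statement — census rule F2)

* SEARCH problem, fixed encoding: the hypothesis is stated with D12
  (`ChenJinWilliams2019.SearchMCSPSolvableAt 𝒞 s m`, `SearchMagnification.lean`): `search-MCSP[s]`
  at arity `m` (input length `N = 2^m`) is SOLVED by a tuple of `descLen (s m) + 1` single-output
  devices from the length-indexed function class `𝒞 (2^m)` (print's multi-output circuit of size
  `t` and depth `D` yields each output bit by a sub-circuit of size `≤ t` and depth `≤ D`, so the
  typed solver class CONTAINS print's: "no typed solver" ⇒ "no printed circuit").  The printed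
  *"does not have … circuits"* is the i.o. reading `¬ ∀ᶠ m, solvable` (the hypothesis only has to
  fail print's circuits infinitely often — the weakest reading, and the one the contrapositive proof
  delivers: `NP ⊆ TC⁰` gives circuits at EVERY length).
* ORACLE: `A = ∅ ∈ PH` (resp. `∈ C`); `search-MCSP^∅ = search-MCSP`, so the typed hypothesis is the
  printed one at one admissible oracle.
* `TC⁰` circuits of bullet 1: the class `ltfGateFns d M` — circuits over arbitrary LINEAR THRESHOLD
  gates (`ChenJinWilliams2019.ltfBasis ⊇ tcBasis ⊇ {¬, ∧ₖ, ∨ₖ, MAJₖ}`), `acDepth ≤ d` (negations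
  free), at most `M N` GATES.  Print's "TC⁰ circuit" (majority/threshold gates, [AB09] Def. 6.1 size
  = number of gates/vertices) is in this class whatever the fine print, and a circuit with `≤ W` wires
  has `≤ W + 1` gates, so a wires reading of "N^{1+ε}-size" is covered too (up to the `+1` absorbed by
  the ceiling `⌈N^{1+ε}⌉` at large `N`, and exactly by `powCeil` monotonicity arguments left to users):
  the typed class is LARGER than print's, the typed hypothesis STRONGER, the typed fact IMPLIED.
  "`O(1/ε)`-depth": the hidden constant depends on the assumed `TC⁰` circuits for the `NP`-complete
  problem (their depth and size exponent enter via Circuit-Min-Merge), so it is NOT a universal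
  constant; the implied rendering is the hypothesis at EVERY constant depth `d` (`∀ d`), which print's
  hypothesis (at depth `κ/ε` for the relevant `κ`) is an instance of.  `2^{εn/c}` ↦ `⌊2^{εm/c}⌋`
  (a size threshold is an integer part), `N^{1+ε}` ↦ `⌈N^{1+ε}⌉ = powCeil (1+ε) N`.
* "circuits of `N · poly(s(n))` size and `O(log N)` depth" (bullet 2) / "depth `O(n)` and
  `2^n · s(n)^c` size" (Thm. 1.6): the class `acDepthFns D M` — circuits over the UNBOUNDED fan-in
  basis `acBasis = {¬, ∧ₖ, ∨ₖ}` with `acDepth ≤ D N` and at most `M N` gates.  This contains both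
  readings of print's "circuits": bounded fan-in (De Morgan / `NC¹`-style, Valiant's depth–size
  question quoted on chunk p0004: *"proving even lower bounds for O(N)-size O(log N)-depth circuits
  remains an open challenge"*) and the unbounded fan-in "AC circuit family" that Theorem 1.1 actually
  outputs (chunk p0007: *"In this paper, an AC circuit family is any circuit family over the basis of
  NOT, unbounded fan-in OR, and unbounded fan-in AND."*) — a `B₂` gate such as `⊕₂` costs
  three `acBasis` gates and two levels, absorbed by the constants `k` below.  `poly(s)` and `O(·)` ↦
  one exponent/constant `k` (`∃ k`, monotone: `ltfGateFns_mono`, `acDepthFns_mono`).  Bullet 2 keeps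
  print's standing hypothesis `s(n) ≥ n`; Thm. 1.6 states none and we ADD `s(n) ≥ n` (a typed
  hypothesis may only be stronger).
* CONCLUSIONS: `¬ (NP ⊆ TC0)`, `¬ (NP ⊆ NC1)` with the tree's every-length classes
  `Literature.Computability.Complexity.TC0` / `NC1` (the every-length class is the smallest reading
  of print's non-uniform `TC⁰`/`NC¹`, so its negated containment is the weakest conclusion); Thm. 1.6
  is typed for `C = PSPACE` — the largest class in the §1 list, hence the weakest printed conclusion,
  and `∅ ∈ PSPACE` — as `¬ (PSPACE ⊆ NC1)` (print: *"C does not have polynomial-size formulas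
  (i.e., C ⊄ NC¹)"*; the `NC¹` phrasing is the weaker of the two synonymous printed forms since every
  every-length `NC¹` family unfolds into polynomial-size formulas).  `⊕P`, `PP` have no tree decl.
* NON-VACUITY (F1): every class `ltfGateFns d M N` / `acDepthFns D M N` contains the projections
  (`input_mem_*`, no gates) and, for `d ≥ 1`, `M N ≥ 1`, the constants (`const_mem_*`); solvability
  by ALL functions holds (`ChenJinWilliams2019.searchMCSPSolvableAt_univ`), so each hypothesis denies
  solvability only at the printed SMALL size/depth — an open lower bound, asserted nowhere here.
  Decision hardness feeds every hypothesis (`ChenJinWilliams2019.not_searchMCSPSolvableAt_of_sliceFn_not_mem`).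

Nothing in this file is proved from the literature: `thm14_tc0`, `thm14_nc1`, `thm16` are named
`Prop`s (OPEN implications' statements, used as hypotheses `(hT : thm14_tc0)` by the census file
`MagnificationGapCensus.lean`, rows R31 / R32 / R40).
-/

namespace Literature.Computability.MetaComplexity.McKayMurrayWilliams2019

open Filter Literature.Computability.Complexity Literature.Computability.Complexity.Nondeterministic
open Literature.Computability.MetaComplexity Literature.Computability.MetaComplexity.ChenJinWilliams2019

/-! ### The two device classes (length-indexed function classes, as D12 wants them) -/

/-- Functions computed at length `n` by circuits over LINEAR THRESHOLD gates (`ltfBasis`) of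
`acDepth ≤ d` (negations free) with at most `M n` gates — the per-length function class of
"`M(n)`-size depth-`d` `TC⁰` circuits" (size = gates; see the module docstring for why this
contains print's class). [cite: MckayMurrayWilliams2019, Thm. 1.4 first bullet ("N^{1+ε}-size O(1/ε)-depth TC⁰ circuits")] -/
def ltfGateFns (d : ℕ) (M : ℕ → ℕ) : ∀ n : ℕ, Set ((Fin n → Bool) → Bool) :=
  ChenJinWilliams2020.circuitFns fun n C => C.IsOver ltfBasis ∧ C.acDepth ≤ d ∧ C.size ≤ M n

/-- Functions computed at length `n` by circuits over the unbounded fan-in basis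
`acBasis = {¬, ∧ₖ, ∨ₖ}` of `acDepth ≤ D n` with at most `M n` gates — the per-length function class of
"circuits of `M` size and `D` depth" (contains the bounded fan-in reading; module docstring).
[cite: MckayMurrayWilliams2019, Thm. 1.4 second bullet ("circuits of N·poly(s(n)) size and O(log N) depth")] -/
def acDepthFns (D M : ℕ → ℕ) : ∀ n : ℕ, Set ((Fin n → Bool) → Bool) :=
  ChenJinWilliams2020.circuitFns fun n C => C.IsOver acBasis ∧ C.acDepth ≤ D n ∧ C.size ≤ M n

/-- The size parameter `2^{εn/c}` of the first bullet, as an integer threshold `⌊2^{ε m / c}⌋`.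
[cite: MckayMurrayWilliams2019, Thm. 1.4 first bullet (search-MCSP[2^{εn/c}])] -/
noncomputable def expFrac (ε : ℝ) (c : ℕ) (m : ℕ) : ℕ := ⌊(2 : ℝ) ^ (ε * m / c)⌋₊

/-! ### The three printed implications, as named statements -/

/-- **McKay–Murray–Williams 2019, Theorem 1.4, first bullet (`A = ∅`)** — census row R31.
Printed: *"If there exists an ε > 0 such that for every c ≥ 1, the problem search-MCSP^A[2^{εn/c}] on
inputs of length N = 2^n does not have N^{1+ε}-size O(1/ε)-depth TC⁰ circuits, then NP ⊄ TC⁰."*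
Typed hypothesis: some `ε > 0` such that for EVERY constant depth `d` and every `c ≥ 1`,
`search-MCSP[⌊2^{εm/c}⌋]` is not solved (i.o. in `m`) by tuples of LTF circuits of `acDepth ≤ d` and
`≤ ⌈N^{1+ε}⌉` gates, `N = 2^m`. OPEN — a named `Prop`, never asserted.
[cite: MckayMurrayWilliams2019, Thm. 1.4 (first bullet, A = ∅), STOC 2019 §1.1 / §5] -/
def thm14_tc0 : Prop :=
  (∃ ε : ℝ, 0 < ε ∧ ∀ d : ℕ, ∀ c : ℕ, 1 ≤ c →
      ¬ ∀ᶠ m : ℕ in atTop,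
        SearchMCSPSolvableAt (ltfGateFns d (powCeil (1 + ε))) (expFrac ε c) m) →
  ¬ (NP ⊆ TC0)

/-- **McKay–Murray–Williams 2019, Theorem 1.4, second bullet (`A = ∅`)** — census row R32.
Printed: *"Let s(n) ≥ n … If search-MCSP^A[s(n)] on inputs of length N = 2^n does not have circuits
of N · poly(s(n)) size and O(log N) depth, then NP ⊄ NC¹."* Typed hypothesis: for NO `k` is
`search-MCSP[s]` solved (a.e. in `m`) by tuples of `acBasis`-circuits of `acDepth ≤ k·m + k` and
`≤ N·s(m)^k + k` gates (`N = 2^m`, `log N = m`). OPEN — a named `Prop`.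
[cite: MckayMurrayWilliams2019, Thm. 1.4 (second bullet, A = ∅), STOC 2019 §1.1 / §5] -/
def thm14_nc1 : Prop :=
  ∀ s : ℕ → ℕ, (∀ n, n ≤ s n) →
    (¬ ∃ k : ℕ, ∀ᶠ m : ℕ in atTop,
        SearchMCSPSolvableAt (acDepthFns (fun _ => k * m + k) fun n => n * s m ^ k + k) s m) →
    ¬ (NP ⊆ NC1)

/-- **McKay–Murray–Williams 2019, Theorem 1.6 (`C = PSPACE`, `A = ∅`)** — census row R40.
Printed: *"Suppose there is some s(n) and oracle A ∈ C such that for all c ≥ 1, search-MCSP^A[s(n)]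
on inputs of length 2^n has no circuits of depth O(n) and 2^n · s(n)^c size. Then C does not have
polynomial-size formulas (i.e., C ⊄ NC¹)."* Typed for the largest listed class `C = PSPACE` with
the added standing hypothesis `s(n) ≥ n`: for NO `k` is `search-MCSP[s]` solved (a.e. in `m`) by
tuples of `acBasis`-circuits of `acDepth ≤ k·m + k` and `≤ 2^m·s(m)^k + k` gates; conclusion
`PSPACE ⊄ NC¹`. (For `C = NP` the statement is the second bullet of Thm. 1.4, `thm14_nc1`.) OPEN —
a named `Prop`. [cite: MckayMurrayWilliams2019, Thm. 1.6 (C = PSPACE, A = ∅), STOC 2019 §1.1 / §5] -/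
def thm16 : Prop :=
  ∀ s : ℕ → ℕ, (∀ n, n ≤ s n) →
    (¬ ∃ k : ℕ, ∀ᶠ m : ℕ in atTop,
        SearchMCSPSolvableAt (acDepthFns (fun _ => k * m + k) fun n => n * s m ^ k + k) s m) →
    ¬ (PSPACE ⊆ NC1)

/-! ### API (all proved): monotonicity and non-vacuity of the device classes -/

/-- `ltfGateFns` is monotone in depth and size. [folklore] -/
theorem ltfGateFns_mono {d d' : ℕ} (hd : d ≤ d') {M M' : ℕ → ℕ} {n : ℕ} (hM : M n ≤ M' n) :
    ltfGateFns d M n ⊆ ltfGateFns d' M' n :=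
  ChenJinWilliams2020.circuitFns_mono fun _ hC => ⟨hC.1, hC.2.1.trans hd, hC.2.2.trans hM⟩

/-- `acDepthFns` is monotone in depth and size. [folklore] -/
theorem acDepthFns_mono {D D' M M' : ℕ → ℕ} {n : ℕ} (hD : D n ≤ D' n) (hM : M n ≤ M' n) :
    acDepthFns D M n ⊆ acDepthFns D' M' n :=
  ChenJinWilliams2020.circuitFns_mono fun _ hC => ⟨hC.1, hC.2.1.trans hD, hC.2.2.trans hM⟩

/-- `acBasis`-circuits are LTF circuits: `acDepthFns (fun _ => d) M n ⊆ ltfGateFns d M n`. [folklore] -/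
theorem acDepthFns_subset_ltfGateFns (d : ℕ) (M : ℕ → ℕ) (n : ℕ) :
    acDepthFns (fun _ => d) M n ⊆ ltfGateFns d M n :=
  ChenJinWilliams2020.circuitFns_mono fun _ hC => ⟨hC.1.mono acBasis_subset_ltfBasis, hC.2.1, hC.2.2⟩

/-- Non-vacuity (F1): every projection `x ↦ x i` is in `ltfGateFns d M n` (no gates, depth `0`).
[folklore] -/
theorem input_mem_ltfGateFns (d : ℕ) (M : ℕ → ℕ) {n : ℕ} (i : Fin n) :
    (fun x : Fin n → Bool => x i) ∈ ltfGateFns d M n :=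
  ⟨Circuit.input i, ⟨Circuit.isOver_input ltfBasis i,
    by rw [OliveiraSanthanam2018.acDepth_input]; exact Nat.zero_le _,
    by rw [Circuit.size_input]; exact Nat.zero_le _⟩, fun x => Circuit.eval_input i x⟩

/-- Non-vacuity (F1): every projection is in `acDepthFns D M n`. [folklore] -/
theorem input_mem_acDepthFns (D M : ℕ → ℕ) {n : ℕ} (i : Fin n) :
    (fun x : Fin n → Bool => x i) ∈ acDepthFns D M n :=
  ⟨Circuit.input i, ⟨Circuit.isOver_input acBasis i,
    by rw [OliveiraSanthanam2018.acDepth_input]; exact Nat.zero_le _,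
    by rw [Circuit.size_input]; exact Nat.zero_le _⟩, fun x => Circuit.eval_input i x⟩

/-- Non-vacuity (F1): the constants are in `acDepthFns D M n` once `D n ≥ 1` and `M n ≥ 1` (one gate
`∧₀`/`∨₀`). [folklore] -/
theorem const_mem_acDepthFns {D M : ℕ → ℕ} {n : ℕ} (hD : 1 ≤ D n) (hM : 1 ≤ M n) (b : Bool) :
    (fun _ : Fin n → Bool => b) ∈ acDepthFns D M n :=
  ⟨Circuit.const (Fin n) b, ⟨Circuit.const_isOver_acBasis b,
    by rw [Circuit.acDepth_const]; exact hD, by rw [Circuit.size_const]; exact hM⟩,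
    fun x => Circuit.eval_const b x⟩

/-- Non-vacuity (F1): the constants are in `ltfGateFns d M n` once `d ≥ 1` and `M n ≥ 1`. [folklore] -/
theorem const_mem_ltfGateFns {d : ℕ} {M : ℕ → ℕ} {n : ℕ} (hd : 1 ≤ d) (hM : 1 ≤ M n) (b : Bool) :
    (fun _ : Fin n → Bool => b) ∈ ltfGateFns d M n :=
  acDepthFns_subset_ltfGateFns d M n (const_mem_acDepthFns (D := fun _ => d) hd hM b)

/-- The bullet-1 hypothesis is ANTITONE in the depth allowed: hardness against depth `d'` gives
hardness against every `d ≤ d'`. [folklore] -/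
theorem not_solvable_ltf_anti {d d' : ℕ} (hd : d ≤ d') {M : ℕ → ℕ} {s : ℕ → ℕ} {m : ℕ}
    (h : ¬ SearchMCSPSolvableAt (ltfGateFns d' M) s m) : ¬ SearchMCSPSolvableAt (ltfGateFns d M) s m :=
  fun hs => h (hs.mono fun _ => ltfGateFns_mono hd le_rfl)

/-- The solver class of bullet 2 / Thm. 1.6 grows with `k`: solvability at exponent `k` gives
solvability at every `k' ≥ k` (for `s(m) ≥ 1`). [folklore] -/
theorem solvable_acDepth_mono {s : ℕ → ℕ} {m k k' : ℕ} (hk : k ≤ k') (hs : 1 ≤ s m)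
    (h : SearchMCSPSolvableAt (acDepthFns (fun _ => k * m + k) fun n => n * s m ^ k + k) s m) :
    SearchMCSPSolvableAt (acDepthFns (fun _ => k' * m + k') fun n => n * s m ^ k' + k') s m :=
  h.mono fun _ => acDepthFns_mono (D := fun _ => k * m + k) (D' := fun _ => k' * m + k')
    (M := fun n => n * s m ^ k + k) (M' := fun n => n * s m ^ k' + k')
    (Nat.add_le_add (Nat.mul_le_mul_right _ hk) hk)
    (Nat.add_le_add (Nat.mul_le_mul_left _ (Nat.pow_le_pow_right hs hk)) hk)

/-- Thm. 1.6 at `C = NP` is LITERALLY the second bullet of Thm. 1.4 (same hypothesis shape; recorded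
so that the census can point at one decl): `thm14_nc1` is that statement. [folklore] -/
theorem thm16_NP_eq_thm14_nc1 :
    (∀ s : ℕ → ℕ, (∀ n, n ≤ s n) →
      (¬ ∃ k : ℕ, ∀ᶠ m : ℕ in atTop,
        SearchMCSPSolvableAt (acDepthFns (fun _ => k * m + k) fun n => n * s m ^ k + k) s m) →
      ¬ (NP ⊆ NC1)) ↔ thm14_nc1 :=
  Iff.rfl

end Literature.Computability.MetaComplexity.McKayMurrayWilliams2019
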